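import Summits.HodgeConjecture.HodgeConjecture.Theorems.Ring2WeilCoverageSchurDefectB
import HarnessLib

/-!
# Weil-type family coverage — THEOREM S3/S4/S5 arithmetic, part C: the `2T` hidden-factor law's further instances and the
`PSL₂(𝔽₁₁)` data predicted by THEOREM S4

research route conditional on HC_CM; not a corollary; Q11.4-sentence-2 already refuted in dim ≥ 3.

Ring 2, WEIL-TYPE FAMILY-COVERAGE CENSUS (`HOME/WEIL-FAMILY-COVERAGE.md` `## b04`, block b04.12 P.S. 2, owner ring2-b04, gen 48);
third part of `Ring2WeilCoverageSchurDefect` (imports part B).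

* §1 the `2T` HIDDEN-FACTOR THEOREM's instances (census b04.12 P.S. 2 (Q1): the `2′`-factor `B` of a `2T = SL₂(𝔽₃)`-curve is on the
  NON-split `ℚ(√-3)`-row iff the number of branch points with monodromy `−1` is odd): literal classes of the NEW non-split SIXFOLD
  factors on `W6.3.2 = (3, ℚ(√-3), [2])` — pub-hsemireg's row R1 — from `(0; 6,6,6′,6′,2)` (genus 23), `(1; 4,4,2)` (genus 25),
  `(0; 3,3′,4,4,4,2)` (genus 26), `(1; 6,6′,2)` (genus 27), and of non-split / split FOURFOLD factors (`W4.3.2` / `W4.3.1`).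
* §2 the `PSL₂(𝔽₁₁)` `η`-pieces returned by the kit wave of b04.12 (C): literal determinants (in the engine's frame) and their
  classes — every one the SPLIT class, as THEOREM S4 predicted before the computation (norm witnesses found constructively).

No `def`, no named fact, no `sorry`; nothing here is a statement about Hodge classes; `HC_CM` is used nowhere.
References: [cite: vanGeemen1994HodgeAV, (5.4.1)]; [cite: BraunNebe2017, §5.2].
-/

set_option linter.dupNamespace false

open Literature.AlgebraicGeometry.Motives
open Literature.AlgebraicGeometry.VanGeemen1994
open Summit.HodgeConjecture.HodgeConjecture.Ring2.Hypotheses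

namespace Summit.HodgeConjecture.HodgeConjecture.Ring2.WeilCoverage

/-! ### §1 `2T` hidden factors: the R1 sixfolds and the `W4.3.2` fourfolds -/
/-- `2T`-cover `(0; c6a,c6a,c6b,c6b,z)` (genus 23, Hurwitz dimension 2): the FACTOR `B` of the even-degree piece `P = B^d` — an abelian sixfold with `(3,3)` `ℚ(√-3)`-action — has literal `det H|_B = -72`, `a = 72`: row `W6.3.2` (NON-split); the census row of `P` itself is `W12.3.1`.
research route conditional on HC_CM; not a corollary; Q11.4-sentence-2 already refuted in dim ≥ 3. [cite: vanGeemen1994HodgeAV, (5.4.1)] -/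
theorem factor2T_6a6a6b6bz_q0_g23_mk_detH_ne_split :
    (QuotientGroup.mk (Units.mk0 ((-72 : ℚ)) (by norm_num)) : weilNormResidueGroup 3) ≠
      splitDiscriminantClass 3 3 := by
  have e : Units.mk0 ((-72 : ℚ)) (by norm_num) = -(Units.mk0 (72 : ℚ) (by norm_num)) := Units.ext (by norm_num)
  rw [Ne, e, mk_neg_eq_splitDiscriminantClass_iff_of_odd (n := 3) (by decide)]
  have h := mul_not_mem_normUnitsSubgroup (mem_normUnitsSubgroup_of_sq_add_mul_sq (d := 3) (a := (36 : ℚ)) (by norm_num) (6 : ℚ) (0 : ℚ) (by norm_num))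
    Summit.HodgeConjecture.Ring2WeilNormDescent.two_not_mem_norm_three
  rw [mk0_mul_mk0] at h
  norm_num at h
  exact h

/-- `2T`-cover `(1; c4,c4,z)` (genus 25, Hurwitz dimension 3): the FACTOR `B` of the even-degree piece `P = B^d` — an abelian sixfold with `(3,3)` `ℚ(√-3)`-action — has literal `det H|_B = -27/2`, `a = 27/2`: row `W6.3.2` (NON-split); the census row of `P` itself is `W12.3.1`.
research route conditional on HC_CM; not a corollary; Q11.4-sentence-2 already refuted in dim ≥ 3. [cite: vanGeemen1994HodgeAV, (5.4.1)] -/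
theorem factor2T_44z_q1_g25_mk_detH_ne_split :
    (QuotientGroup.mk (Units.mk0 (((-27 : ℚ) / 2)) (by norm_num)) : weilNormResidueGroup 3) ≠
      splitDiscriminantClass 3 3 := by
  have e : Units.mk0 (((-27 : ℚ) / 2)) (by norm_num) = -(Units.mk0 ((27 : ℚ) / 2) (by norm_num)) := Units.ext (by norm_num)
  rw [Ne, e, mk_neg_eq_splitDiscriminantClass_iff_of_odd (n := 3) (by decide)]
  have h := mul_not_mem_normUnitsSubgroup (mem_normUnitsSubgroup_of_sq_add_mul_sq (d := 3) (a := ((27 : ℚ) / 4)) (by norm_num) (0 : ℚ) ((3 : ℚ) / 2) (by norm_num))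
    Summit.HodgeConjecture.Ring2WeilNormDescent.two_not_mem_norm_three
  rw [mk0_mul_mk0] at h
  norm_num at h
  exact h

/-- `2T`-cover `(0; c3a,c3b,c4,c4,c4,z)` (genus 26, Hurwitz dimension 3): the FACTOR `B` of the even-degree piece `P = B^d` — an abelian sixfold with `(3,3)` `ℚ(√-3)`-action — has literal `det H|_B = -72`, `a = 72`: row `W6.3.2` (NON-split); the census row of `P` itself is `W12.3.1`.
research route conditional on HC_CM; not a corollary; Q11.4-sentence-2 already refuted in dim ≥ 3. [cite: vanGeemen1994HodgeAV, (5.4.1)] -/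
theorem factor2T_3a3b444z_q0_g26_mk_detH_ne_split :
    (QuotientGroup.mk (Units.mk0 ((-72 : ℚ)) (by norm_num)) : weilNormResidueGroup 3) ≠
      splitDiscriminantClass 3 3 :=
  factor2T_6a6a6b6bz_q0_g23_mk_detH_ne_split

/-- `2T`-cover `(1; c6a,c6b,z)` (genus 27, Hurwitz dimension 3): the FACTOR `B` of the even-degree piece `P = B^d` — an abelian sixfold with `(3,3)` `ℚ(√-3)`-action — has literal `det H|_B = -351/2`, `a = 351/2`: row `W6.3.2` (NON-split); the census row of `P` itself is `W12.3.1`.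
research route conditional on HC_CM; not a corollary; Q11.4-sentence-2 already refuted in dim ≥ 3. [cite: vanGeemen1994HodgeAV, (5.4.1)] -/
theorem factor2T_6a6bz_q1_g27_mk_detH_ne_split :
    (QuotientGroup.mk (Units.mk0 (((-351 : ℚ) / 2)) (by norm_num)) : weilNormResidueGroup 3) ≠
      splitDiscriminantClass 3 3 := by
  have e : Units.mk0 (((-351 : ℚ) / 2)) (by norm_num) = -(Units.mk0 ((351 : ℚ) / 2) (by norm_num)) := Units.ext (by norm_num)
  rw [Ne, e, mk_neg_eq_splitDiscriminantClass_iff_of_odd (n := 3) (by decide)]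
  have h := mul_not_mem_normUnitsSubgroup (mem_normUnitsSubgroup_of_sq_add_mul_sq (d := 3) (a := ((351 : ℚ) / 4)) (by norm_num) ((-9 : ℚ) / 4) ((21 : ℚ) / 4) (by norm_num))
    Summit.HodgeConjecture.Ring2WeilNormDescent.two_not_mem_norm_three
  rw [mk0_mul_mk0] at h
  norm_num at h
  exact h

-- `2T`-cover `(1; 4,2)` (genus 16): factor fourfold with `det H|_B = 18` — the SAME literal class statement as part B's
-- `factor2T_46a6bz_g12_mk_detH_ne_split` (`[18] ≠ split(2,3)`, row `W4.3.2`); not restated (reuse that declaration).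

/-- `2T`-cover `(0; c3a,c3b,c4,c4,z)` (genus 17, Hurwitz dimension 2): the FACTOR `B` of the even-degree piece `P = B^d` — an abelian fourfold with `(2,2)` `ℚ(√-3)`-action — has literal `det H|_B = 24`, `a = 24`: row `W4.3.2` (NON-split); the census row of `P` itself is `W8.3.1`.
research route conditional on HC_CM; not a corollary; Q11.4-sentence-2 already refuted in dim ≥ 3. [cite: vanGeemen1994HodgeAV, (5.4.1)] -/
theorem factor2T_3a3b44z_q0_g17_mk_detH_ne_split :
    (QuotientGroup.mk (Units.mk0 ((24 : ℚ)) (by norm_num)) : weilNormResidueGroup 3) ≠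
      splitDiscriminantClass 2 3 := by
  have e : Units.mk0 ((24 : ℚ)) (by norm_num) = Units.mk0 (24 : ℚ) (by norm_num) := Units.ext (by norm_num)
  rw [Ne, e, mk_eq_splitDiscriminantClass_iff_of_even (n := 2) (by decide)]
  have h := mul_not_mem_normUnitsSubgroup (mem_normUnitsSubgroup_of_sq_add_mul_sq (d := 3) (a := (12 : ℚ)) (by norm_num) (0 : ℚ) (2 : ℚ) (by norm_num))
    Summit.HodgeConjecture.Ring2WeilNormDescent.two_not_mem_norm_three
  rw [mk0_mul_mk0] at h
  norm_num at h
  exact h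

/-- `2T`-cover `(1; c4,c4)` (genus 19, Hurwitz dimension 2): the FACTOR `B` of the even-degree piece `P = B^d` — an abelian fourfold with `(2,2)` `ℚ(√-3)`-action — has literal `det H|_B = 9/4`, `a = 9/4`: row `W4.3.1` (SPLIT); the census row of `P` itself is `W8.3.1`.
research route conditional on HC_CM; not a corollary; Q11.4-sentence-2 already refuted in dim ≥ 3. [cite: vanGeemen1994HodgeAV, (5.4.1)] -/
theorem factor2T_44_q1_g19_mk_detH_eq_split :
    (QuotientGroup.mk (Units.mk0 (((9 : ℚ) / 4)) (by norm_num)) : weilNormResidueGroup 3) =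
      splitDiscriminantClass 2 3 := by
  have e : Units.mk0 (((9 : ℚ) / 4)) (by norm_num) = Units.mk0 ((9 : ℚ) / 4) (by norm_num) := Units.ext (by norm_num)
  rw [e, mk_eq_splitDiscriminantClass_iff_of_even (n := 2) (by decide)]
  exact mem_normUnitsSubgroup_of_sq_add_mul_sq _ ((3 : ℚ) / 2) (0 : ℚ) (by norm_num)

/-- `2T`-cover `(1; c6a,c6b)` (genus 21, Hurwitz dimension 2): the FACTOR `B` of the even-degree piece `P = B^d` — an abelian fourfold with `(2,2)` `ℚ(√-3)`-action — has literal `det H|_B = 12`, `a = 12`: row `W4.3.1` (SPLIT); the census row of `P` itself is `W8.3.1`.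
research route conditional on HC_CM; not a corollary; Q11.4-sentence-2 already refuted in dim ≥ 3. [cite: vanGeemen1994HodgeAV, (5.4.1)] -/
theorem factor2T_6a6b_q1_g21_mk_detH_eq_split :
    (QuotientGroup.mk (Units.mk0 ((12 : ℚ)) (by norm_num)) : weilNormResidueGroup 3) =
      splitDiscriminantClass 2 3 := by
  have e : Units.mk0 ((12 : ℚ)) (by norm_num) = Units.mk0 (12 : ℚ) (by norm_num) := Units.ext (by norm_num)
  rw [e, mk_eq_splitDiscriminantClass_iff_of_even (n := 2) (by decide)]
  exact mem_normUnitsSubgroup_of_sq_add_mul_sq _ (0 : ℚ) (2 : ℚ) (by norm_num)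

/-- `2T`-cover `(1; c3a,c3b,z)` (genus 23, Hurwitz dimension 3): the FACTOR `B` of the even-degree piece `P = B^d` — an abelian fourfold with `(2,2)` `ℚ(√-3)`-action — has literal `det H|_B = 3/2`, `a = 3/2`: row `W4.3.2` (NON-split); the census row of `P` itself is `W8.3.1`.
research route conditional on HC_CM; not a corollary; Q11.4-sentence-2 already refuted in dim ≥ 3. [cite: vanGeemen1994HodgeAV, (5.4.1)] -/
theorem factor2T_3a3bz_q1_g23_mk_detH_ne_split :
    (QuotientGroup.mk (Units.mk0 (((3 : ℚ) / 2)) (by norm_num)) : weilNormResidueGroup 3) ≠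
      splitDiscriminantClass 2 3 := by
  have e : Units.mk0 (((3 : ℚ) / 2)) (by norm_num) = Units.mk0 ((3 : ℚ) / 2) (by norm_num) := Units.ext (by norm_num)
  rw [Ne, e, mk_eq_splitDiscriminantClass_iff_of_even (n := 2) (by decide)]
  have h := mul_not_mem_normUnitsSubgroup (mem_normUnitsSubgroup_of_sq_add_mul_sq (d := 3) (a := ((3 : ℚ) / 4)) (by norm_num) (0 : ℚ) ((1 : ℚ) / 2) (by norm_num))
    Summit.HodgeConjecture.Ring2WeilNormDescent.two_not_mem_norm_three
  rw [mk0_mul_mk0] at h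
  norm_num at h
  exact h

/-- `2T`-cover `(2; z)` (genus 31, Hurwitz dimension 4): the FACTOR `B` of the even-degree piece `P = B^d` — an abelian sixfold with `(3,3)` `ℚ(√-3)`-action — has literal `det H|_B = -279/2`, `a = 279/2`: row `W6.3.2` (NON-split); the census row of `P` itself is `W12.3.1`.
research route conditional on HC_CM; not a corollary; Q11.4-sentence-2 already refuted in dim ≥ 3. [cite: vanGeemen1994HodgeAV, (5.4.1)] -/
theorem factor2T_z_q2_g31_mk_detH_ne_split :
    (QuotientGroup.mk (Units.mk0 (((-279 : ℚ) / 2)) (by norm_num)) : weilNormResidueGroup 3) ≠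
      splitDiscriminantClass 3 3 := by
  have e : Units.mk0 (((-279 : ℚ) / 2)) (by norm_num) = -(Units.mk0 ((279 : ℚ) / 2) (by norm_num)) := Units.ext (by norm_num)
  rw [Ne, e, mk_neg_eq_splitDiscriminantClass_iff_of_odd (n := 3) (by decide)]
  have h := mul_not_mem_normUnitsSubgroup (mem_normUnitsSubgroup_of_sq_add_mul_sq (d := 3) (a := ((279 : ℚ) / 4)) (by norm_num) ((33 : ℚ) / 4) ((3 : ℚ) / 4) (by norm_num))
    Summit.HodgeConjecture.Ring2WeilNormDescent.two_not_mem_norm_three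
  rw [mk0_mul_mk0] at h
  norm_num at h
  exact h

/-- `2T`-cover `(1; c3a,c3a,c6a,z)` (genus 33, Hurwitz dimension 4): the FACTOR `B` of the even-degree piece `P = B^d` — an abelian sixfold with `(3,3)` `ℚ(√-3)`-action — has literal `det H|_B = -24`, `a = 24`: row `W6.3.2` (NON-split); the census row of `P` itself is `W12.3.1`.
research route conditional on HC_CM; not a corollary; Q11.4-sentence-2 already refuted in dim ≥ 3. [cite: vanGeemen1994HodgeAV, (5.4.1)] -/
theorem factor2T_3a3a6az_q1_g33_mk_detH_ne_split :
    (QuotientGroup.mk (Units.mk0 ((-24 : ℚ)) (by norm_num)) : weilNormResidueGroup 3) ≠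
      splitDiscriminantClass 3 3 := by
  have e : Units.mk0 ((-24 : ℚ)) (by norm_num) = -(Units.mk0 (24 : ℚ) (by norm_num)) := Units.ext (by norm_num)
  rw [Ne, e, mk_neg_eq_splitDiscriminantClass_iff_of_odd (n := 3) (by decide)]
  have h := mul_not_mem_normUnitsSubgroup (mem_normUnitsSubgroup_of_sq_add_mul_sq (d := 3) (a := (12 : ℚ)) (by norm_num) (0 : ℚ) (2 : ℚ) (by norm_num))
    Summit.HodgeConjecture.Ring2WeilNormDescent.two_not_mem_norm_three
  rw [mk0_mul_mk0] at h
  norm_num at h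
  exact h

/-- `2T`-cover `(2; c4)` (genus 34, Hurwitz dimension 4): the FACTOR `B` of the even-degree piece `P = B^d` — an abelian sixfold with `(3,3)` `ℚ(√-3)`-action — has literal `det H|_B = -351/64`, `a = 351/64`: row `W6.3.1` (SPLIT); the census row of `P` itself is `W12.3.1`.
research route conditional on HC_CM; not a corollary; Q11.4-sentence-2 already refuted in dim ≥ 3. [cite: vanGeemen1994HodgeAV, (5.4.1)] -/
theorem factor2T_4_q2_g34_mk_detH_eq_split :
    (QuotientGroup.mk (Units.mk0 (((-351 : ℚ) / 64)) (by norm_num)) : weilNormResidueGroup 3) =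
      splitDiscriminantClass 3 3 := by
  have e : Units.mk0 (((-351 : ℚ) / 64)) (by norm_num) = -(Units.mk0 ((351 : ℚ) / 64) (by norm_num)) := Units.ext (by norm_num)
  rw [e, mk_neg_eq_splitDiscriminantClass_iff_of_odd (n := 3) (by decide)]
  exact mem_normUnitsSubgroup_of_sq_add_mul_sq _ ((-9 : ℚ) / 16) ((21 : ℚ) / 16) (by norm_num)


/-! ### §2 `PSL₂(𝔽₁₁)`: the pieces predicted split by THEOREM S4 -/

/-- `PSL2(11)`-cover `(0; c3,c3,c5b)` (genus 45, Hurwitz dimension 0; kit engine `psl2x.py`): the `(η₁ ⊕ η₂)`-piece has `m = 2`, `K`-signature `(5,5)` — WEIL TYPE — `dim P = 10`, `K = ℚ(√-11)` through the centre of the group algebra; literal `det H = -270471176125247365925472315324`, `a = (−1)ⁿ det H = 270471176125247365925472315324`: row `W10.11.1` (SPLIT) — as THEOREM S4 of census b04.12 (Borel restriction) PREDICTED before the computation.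
research route conditional on HC_CM; not a corollary; Q11.4-sentence-2 already refuted in dim ≥ 3. [cite: vanGeemen1994HodgeAV, (5.4.1)] -/
theorem tenfold_psl2_11_3x3x5b_g45_q0_mk_detH_eq_split :
    (QuotientGroup.mk (Units.mk0 (-270471176125247365925472315324 : ℚ) (by norm_num)) : weilNormResidueGroup 11) =
      splitDiscriminantClass 5 11 := by
  have e : Units.mk0 (-270471176125247365925472315324 : ℚ) (by norm_num) = -(Units.mk0 (270471176125247365925472315324 : ℚ) (by norm_num)) := Units.ext (by norm_num)
  rw [e, mk_neg_eq_splitDiscriminantClass_iff_of_odd (n := 5) (by decide)]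
  exact mem_normUnitsSubgroup_of_sq_add_mul_sq _ (-484562285922132 : ℚ) (-56945402230530 : ℚ) (by norm_num)

/-- The same class stated positively: `a = 270471176125247365925472315324 = (-484562285922132)² + 11·(-56945402230530)² ∈ Nm(ℚ(√-11)ˣ)`.
research route conditional on HC_CM; not a corollary; Q11.4-sentence-2 already refuted in dim ≥ 3. [cite: vanGeemen1994HodgeAV, (5.4.1)] -/
theorem tenfold_psl2_11_3x3x5b_g45_q0_a_mem_norm :
    Units.mk0 (270471176125247365925472315324 : ℚ) (by norm_num) ∈ normUnitsSubgroup ℚ (weilField 11) :=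
  mem_normUnitsSubgroup_of_sq_add_mul_sq _ (-484562285922132 : ℚ) (-56945402230530 : ℚ) (by norm_num)

/-- `PSL2(11)`-cover `(0; c3,c3,c6)` (genus 56, Hurwitz dimension 0; kit engine `psl2x.py`): the `(η₁ ⊕ η₂)`-piece has `m = 2`, `K`-signature `(5,5)` — WEIL TYPE — `dim P = 10`, `K = ℚ(√-11)` through the centre of the group algebra; literal `det H = -144514398552409629173870763398801/256`, `a = (−1)ⁿ det H = 144514398552409629173870763398801/256`: row `W10.11.1` (SPLIT) — as THEOREM S4 of census b04.12 (Borel restriction) PREDICTED before the computation.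
research route conditional on HC_CM; not a corollary; Q11.4-sentence-2 already refuted in dim ≥ 3. [cite: vanGeemen1994HodgeAV, (5.4.1)] -/
theorem tenfold_psl2_11_3x3x6_g56_q0_mk_detH_eq_split :
    (QuotientGroup.mk (Units.mk0 ((-144514398552409629173870763398801 : ℚ) / 256) (by norm_num)) : weilNormResidueGroup 11) =
      splitDiscriminantClass 5 11 := by
  have e : Units.mk0 ((-144514398552409629173870763398801 : ℚ) / 256) (by norm_num) = -(Units.mk0 ((144514398552409629173870763398801 : ℚ) / 256) (by norm_num)) := Units.ext (by norm_num)
  rw [e, mk_neg_eq_splitDiscriminantClass_iff_of_odd (n := 5) (by decide)]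
  exact mem_normUnitsSubgroup_of_sq_add_mul_sq _ ((-4019445490504323 : ℚ) / 32) ((-7147165058821975 : ℚ) / 32) (by norm_num)

/-- The same class stated positively: `a = 144514398552409629173870763398801/256 = (-4019445490504323/32)² + 11·(-7147165058821975/32)² ∈ Nm(ℚ(√-11)ˣ)`.
research route conditional on HC_CM; not a corollary; Q11.4-sentence-2 already refuted in dim ≥ 3. [cite: vanGeemen1994HodgeAV, (5.4.1)] -/
theorem tenfold_psl2_11_3x3x6_g56_q0_a_mem_norm :
    Units.mk0 ((144514398552409629173870763398801 : ℚ) / 256) (by norm_num) ∈ normUnitsSubgroup ℚ (weilField 11) :=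
  mem_normUnitsSubgroup_of_sq_add_mul_sq _ ((-4019445490504323 : ℚ) / 32) ((-7147165058821975 : ℚ) / 32) (by norm_num)


end Summit.HodgeConjecture.HodgeConjecture.Ring2.WeilCoverage
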